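import Summits.BirchSwinnertonDyer.BirchSwinnertonDyer.Theorems.AlignedTransportAtTwoMainConjectureOfRankZeroBSDAtTwoOrdinaryStandardShape
import Summits.BirchSwinnertonDyer.BirchSwinnertonDyer.Theorems.AlignedTransportAtTwoMainConjectureOfRankZeroBSDAtTwoFineRoadRealKummerLinesLetterSwitchMinimalModel
import Summits.BirchSwinnertonDyer.BirchSwinnertonDyer.Theorems.AlignedTransportAtTwoMainConjectureOfRankZeroBSDAtTwoCubicDiscriminantSquareClass
import HarnessLib

/-!
# Route `AlignedTransportAtTwo`, crux C2 `MainConjectureOfRankZeroBSDAtTwo` (stmt-BirchSwinnertonDyer-22298):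
# THE EXACT IMAGE — every shape cubic `u³ + (1 + 4a₂)u² + 16a₄u + 64a₆` (`a₄ + a₆` odd, no rational root, `Δ[1,a₂,0,a₄,a₆] ∉ ℤ²`) IS the
# `u`-cubic, up to a rational affinity, of a GLOBALLY MINIMAL elliptic curve over `ℚ` that is good ORDINARY at `2`, with `E(ℚ)[2] = 0` and `Δ ∉ ℚ²`;
# hence the cubic `2`-torsion fields of C2's local class are EXACTLY the root fields of shape cubics

HONEST FRAMING. WIDTH-5 attached prover seat `bsd-line-att-p4` g35 on line `birth` of the lead `bsd-line-att-p2` (WAKE-only); `--supports`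
stmt-BirchSwinnertonDyer-22298, closes nothing; BSD is NOT proved; crux C2, its verdict «blocked-on `Rank1Residual.GreenbergMuConjectureIrreducible`»
and every registered stub untouched. THEOREMS ONLY (no `def`, no named fact, no `sorry`); UNCONDITIONAL (Néron's global minimal model over `ℚ` is the
tree THEOREM `hasGlobalMinimalModel_rat_holds`). Sequel of `…OrdinaryStandardShape` (this seat, same gen: every globally minimal `W` good ordinary at `2`
has `c_W(e) = 0 ⟺ g(e − 4r) = 0` for a shape cubic `g` with `a₄ + a₆` odd and `Δ[1,a₂,0,a₄,a₆] = Δ_min(W)`). This file is the CONVERSE, which the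
field-currency binders of g33/g34 (non-cyclic ⊋ dyadic ⊋ dyadic-even) left open («is the binder class exactly the image?», g34 §3): in integer-triple
currency the converse construction is the standard model `[1, a₂, 0, a₄, a₆]` itself, minimised.

* §1 ★★★ `exists_cellCurve_of_standardShape` — **for all integers `a₂, a₄, a₆` with `a₄ + a₆` odd, `x³ + (1+4a₂)x² + 16a₄x + 64a₆` without rational
  root and `Δ[1,a₂,0,a₄,a₆]` not a square, there is `W/ℚ` ELLIPTIC, GLOBALLY MINIMAL, good ORDINARY at `2`, with `W(ℚ)[2] = 0`, `Δ_W ∉ ℚ²`, and rationals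
  `q ≠ 0`, `s` such that in every field `K` of characteristic `0`: `c_W(e) = 0 ⟺ g(qe + s) = 0`** (`W = C • ([1,a₂,0,a₄,a₆] ⊗ ℚ)` a global minimal
  model — Néron; good ordinary at `2` by att-p5 g15's `isOrdinaryAt_two_smul_of_int_model` (`Δ`, `c₄` odd); `q = u²`, `s = 4r` from `c_{C•V}(u⁻²(y − 4r))
  = u⁻⁶c_V(y)`); `exists_cellCurve_of_standardShape_rootField` — the same with «`K ∋` a root of `c_W` ⟺ `K ∋` a root of `g`».
* §2 CONSEQUENCES FOR ROOT FIELDS OF SHAPE CUBICS, W-free in statement (all through the §1 curve and the cell lemmas of g33/g34): a cubic number field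
  `F ∋ e` with `g(e) = 0` is NOT Galois over `ℚ` (`not_isGalois_of_standardShape_root`), EMBEDS INTO `ℚ₂` (`nonempty_ringHom_padic_two_of_standardShape_root`)
  and has `v₂(d_F)` EVEN (`even_padicValInt_two_discr_of_standardShape_root`): the shape class sits inside g34's dyadic-even class, and the three
  field binders of the restatement menu follow the shape binder's hypotheses.
Together with `…OrdinaryStandardShape` §2: **{cubic `2`-torsion fields of globally minimal `W` good ordinary at `2` with `W(ℚ)[2] = 0`, `Δ ∉ ℚ²`} =
{root fields of shape cubics with `a₄ + a₆` odd, no rational root, `Δ ∉ ℤ²`} EXACTLY** — the equivalence of the named inputs is drawn in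
`…OrdinaryStandardShapeCrux`. Expected REF2 grade: TEXTBOOK (Silverman III.1, VII.1, VIII.8) + COROLLARY-OF-TREE. PARTITION: none; beyond-print
theorem: no; BSD is NOT proved by any of this.

References: [SilvermanAEC2009] III.§1 Table 3.1, VII.§1 Prop. 1.3, VII.§5 Prop. 5.1, VIII.§8 Cor. 8.3; [Neron1964]; tree: `…OrdinaryStandardShape` (g35),
`…FineRoadRealKummerLinesLetterSwitch{VariableChange,MinimalModel}` (att-p5 g15), `GlobalMinimalModelProofs` (`hasGlobalMinimalModel_rat_holds`),
`…NarrowCubicNamedInput{,Dyadic}` (g33/g34), `…CubicDiscriminantSquareClass` (g34).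
-/

-- the Theorems namespace of this sub repeats the summit name by design (D-0017 nested layout)
set_option linter.dupNamespace false
set_option autoImplicit false

noncomputable section

open scoped NumberField

namespace Summit.BirchSwinnertonDyer.BirchSwinnertonDyer.Theorems.AlignedTransportAtTwoOrdinaryStandardShapeExact

open NumberField Polynomial WeierstrassCurve
  Literature.NumberTheory.EllipticCurves Literature.NumberTheory.EllipticCurves.Greenberg1999
  Summit.BirchSwinnertonDyer.Rank1Residual.F1Sign2
  Summit.BirchSwinnertonDyer.BirchSwinnertonDyer.Theorems.AlignedTransportAtTwoOrdinaryStandardShape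
  Summit.BirchSwinnertonDyer.BirchSwinnertonDyer.Theorems.AlignedTransportAtTwoNarrowCubicNamedInput
  Summit.BirchSwinnertonDyer.BirchSwinnertonDyer.Theorems.AlignedTransportAtTwoNarrowCubicNamedInputDyadic
  Summit.BirchSwinnertonDyer.BirchSwinnertonDyer.Theorems.AlignedTransportAtTwoCubicDiscriminantSquareClass
  Summit.BirchSwinnertonDyer.BirchSwinnertonDyer.Theorems.AlignedTransportAtTwoFineRoad.RealKummerLinesLetterSwitchVariableChange
  Summit.BirchSwinnertonDyer.BirchSwinnertonDyer.Theorems.AlignedTransportAtTwoFineRoad.RealKummerLinesLetterSwitchMinimalModel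

/-! ## §1 The exact image: every shape cubic is the `u`-cubic of a globally minimal good-ordinary curve -/

section Exact

variable (a₂ a₄ a₆ : ℤ)

/-- ★★★ **THE EXACT IMAGE.** Integers `a₂, a₄, a₆` with `a₄ + a₆` ODD, the shape cubic `g = x³ + (1 + 4a₂)x² + 16a₄x + 64a₆` WITHOUT rational root and
`Δ[1, a₂, 0, a₄, a₆]` NOT a square. Then there is a Weierstrass curve `W/ℚ` which is ELLIPTIC and GLOBALLY MINIMAL, good ORDINARY at `2`, with no rational
`2`-torsion abscissa and `Δ_W ∉ ℚ²`, together with rationals `q ≠ 0`, `s` such that in every field `K` of characteristic `0`: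
`c_W(e) = 0 ⟺ g(q·e + s) = 0`. (`W = C • ([1, a₂, 0, a₄, a₆] ⊗ ℚ)` is a global minimal model — Néron, tree theorem `hasGlobalMinimalModel_rat_holds`; it is
good ordinary at `2` because `Δ` and `c₄` of the integer model are odd — att-p5 g15's `isOrdinaryAt_two_smul_of_int_model`; `E(ℚ)[2] = 0` and `Δ ∉ ℚ²`
are isomorphism invariants; `q = u²`, `s = 4r` by `c_{C•V}(u⁻²(y − 4r)) = u⁻⁶·c_V(y)`.) UNCONDITIONAL. [cite: SilvermanAEC2009, VIII.§8 Cor. 8.3, VII.§1 Prop. 1.3, V.§4, III.§1 Table 3.1]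
[cite: Neron1964] -/
theorem exists_cellCurve_of_standardShape (hodd : Odd (a₄ + a₆))
    (hirr : ∀ x : ℚ, x ^ 3 + (1 + 4 * (a₂ : ℚ)) * x ^ 2 + 16 * (a₄ : ℚ) * x + 64 * (a₆ : ℚ) ≠ 0)
    (hsq : ¬ IsSquare (⟨1, a₂, 0, a₄, a₆⟩ : WeierstrassCurve ℤ).Δ) :
    ∃ (W : WeierstrassCurve ℚ) (_ : W.IsElliptic) (_ : W.IsGloballyMinimal),
      IsOrdinaryAt W 2 ∧ (∀ x : ℚ, ¬ HasRationalTwoTorsionX W x) ∧ ¬ IsSquare W.Δ ∧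
      ∃ q s : ℚ, q ≠ 0 ∧ ∀ {K : Type} [Field K] [CharZero K] [Algebra ℚ K] (e : K),
        aeval e (twoDivisionUCubic W) = 0 ↔
          ((q : K) * e + (s : K)) ^ 3 + (1 + 4 * (a₂ : K)) * ((q : K) * e + (s : K)) ^ 2 +
              16 * (a₄ : K) * ((q : K) * e + (s : K)) + 64 * (a₆ : K) = 0 := by
  haveI hE := isElliptic_standard a₂ a₄ a₆ hodd
  obtain ⟨C, hC⟩ := hasGlobalMinimalModel_rat_holds ((⟨1, a₂, 0, a₄, a₆⟩ : WeierstrassCurve ℤ).baseChange ℚ)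
  haveI := hC
  have hΔ2 : ¬ (2 : ℤ) ∣ (⟨1, a₂, 0, a₄, a₆⟩ : WeierstrassCurve ℤ).Δ :=
    fun h ↦ Int.not_even_iff_odd.mpr ((odd_Δ_standard_iff a₂ a₄ a₆).mpr hodd) (even_iff_two_dvd.mpr h)
  have hc₄2 : ¬ (2 : ℤ) ∣ (⟨1, a₂, 0, a₄, a₆⟩ : WeierstrassCurve ℤ).c₄ :=
    fun h ↦ Int.not_even_iff_odd.mpr (odd_c₄_standard a₂ a₄ a₆) (even_iff_two_dvd.mpr h)
  have hord := (isOrdinaryAt_two_smul_of_int_model (⟨1, a₂, 0, a₄, a₆⟩ : WeierstrassCurve ℤ) hΔ2 hc₄2 C).1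
  have hsq₀ : ¬ IsSquare ((⟨1, a₂, 0, a₄, a₆⟩ : WeierstrassCurve ℤ).baseChange ℚ).Δ := by
    rw [Δ_standard_baseChange]
    exact fun h ↦ hsq (Rat.isSquare_intCast_iff.mp h)
  refine ⟨C • ((⟨1, a₂, 0, a₄, a₆⟩ : WeierstrassCurve ℤ).baseChange ℚ), inferInstance, hC, hord,
    forall_not_hasRationalTwoTorsionX_smul _ C (not_hasRationalTwoTorsionX_standard a₂ a₄ a₆ hirr),
    not_isSquare_Δ_smul _ C hsq₀, (C.u : ℚ) ^ 2, 4 * (C.r : ℚ), pow_ne_zero 2 (Units.ne_zero _), ?_⟩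
  intro K _ _ _ e
  obtain ⟨v, hv⟩ : ∃ v : K, v = (((↑C.u⁻¹ : ℚ)) : K) := ⟨_, rfl⟩
  obtain ⟨y, hy⟩ : ∃ y : K, y = (((C.u : ℚ)) : K) ^ 2 * e + 4 * ((C.r : ℚ) : K) := ⟨_, rfl⟩
  have hvu : v * (((C.u : ℚ)) : K) = 1 := by
    rw [hv, ← Rat.cast_mul, Units.inv_mul, Rat.cast_one]
  have hv0 : v ≠ 0 := fun h ↦ by rw [h, zero_mul] at hvu; exact zero_ne_one hvu
  have hve : v ^ 2 * (y - 4 * ((C.r : ℚ) : K)) = e := by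
    rw [hy, add_sub_cancel_right, ← mul_assoc, ← mul_pow, hvu, one_pow, one_mul]
  have key := cubic_smul ((⟨1, a₂, 0, a₄, a₆⟩ : WeierstrassCurve ℤ).baseChange ℚ) C (K := K) y
  rw [← hv, hve, b₂_standard, b₄_standard, b₆_standard] at key
  push_cast at key
  have hval : aeval e (twoDivisionUCubic (C • ((⟨1, a₂, 0, a₄, a₆⟩ : WeierstrassCurve ℤ).baseChange ℚ))) =
      v ^ 6 * (y ^ 3 + (1 + 4 * (a₂ : K)) * y ^ 2 + 16 * (a₄ : K) * y + 64 * (a₆ : K)) := by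
    rw [aeval_twoDivisionUCubic_eq]
    linear_combination key
  rw [hval, mul_eq_zero, or_iff_right (pow_ne_zero 6 hv0), hy]
  push_cast
  exact Iff.rfl

/-- ★★ **THE EXACT IMAGE, field form**: same hypotheses; the curve `W` of `exists_cellCurve_of_standardShape` has, in every field `K` of characteristic `0`,
**a root of `c_W` iff a root of the shape cubic** — so the root FIELDS of `g` are exactly the cubic `2`-torsion fields `ℚ(x(P))`, `P ∈ W[2] ∖ 0`.
UNCONDITIONAL. [cite: SilvermanAEC2009, VIII.§8 Cor. 8.3 and III.§1] [cite: Neron1964] -/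
theorem exists_cellCurve_of_standardShape_rootField (hodd : Odd (a₄ + a₆))
    (hirr : ∀ x : ℚ, x ^ 3 + (1 + 4 * (a₂ : ℚ)) * x ^ 2 + 16 * (a₄ : ℚ) * x + 64 * (a₆ : ℚ) ≠ 0)
    (hsq : ¬ IsSquare (⟨1, a₂, 0, a₄, a₆⟩ : WeierstrassCurve ℤ).Δ) :
    ∃ (W : WeierstrassCurve ℚ) (_ : W.IsElliptic) (_ : W.IsGloballyMinimal),
      IsOrdinaryAt W 2 ∧ (∀ x : ℚ, ¬ HasRationalTwoTorsionX W x) ∧ ¬ IsSquare W.Δ ∧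
      ∀ {K : Type} [Field K] [CharZero K] [Algebra ℚ K],
        (∃ e : K, aeval e (twoDivisionUCubic W) = 0) ↔
          ∃ y : K, y ^ 3 + (1 + 4 * (a₂ : K)) * y ^ 2 + 16 * (a₄ : K) * y + 64 * (a₆ : K) = 0 := by
  obtain ⟨W, hE, hM, hord, ht, hsqW, q, s, hq, hroot⟩ := exists_cellCurve_of_standardShape a₂ a₄ a₆ hodd hirr hsq
  refine ⟨W, hE, hM, hord, ht, hsqW, ?_⟩
  intro K _ _ _
  constructor
  · rintro ⟨e, he⟩
    exact ⟨(q : K) * e + (s : K), (hroot e).mp he⟩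
  · rintro ⟨y, hyr⟩
    have hqK : (q : K) ≠ 0 := by exact_mod_cast hq
    refine ⟨((y - (s : K)) / (q : K)), (hroot _).mpr ?_⟩
    have hy : (q : K) * ((y - (s : K)) / (q : K)) + (s : K) = y := by field_simp; ring
    rw [hy]
    exact hyr

end Exact

/-! ## §2 Root fields of shape cubics: not Galois, dyadic, `v₂(d_F)` even -/

section RootField

variable {a₂ a₄ a₆ : ℤ}

/-- **A root of a shape cubic in a cubic field is, after a rational affinity, a root of the `u`-cubic of a cell curve** (packaging of §1 for the field
lemmas below). [cite: SilvermanAEC2009, VIII.§8 Cor. 8.3 and III.§1] -/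
theorem exists_cellCurve_root_of_standardShape_root (hodd : Odd (a₄ + a₆))
    (hirr : ∀ x : ℚ, x ^ 3 + (1 + 4 * (a₂ : ℚ)) * x ^ 2 + 16 * (a₄ : ℚ) * x + 64 * (a₆ : ℚ) ≠ 0)
    (hsq : ¬ IsSquare (⟨1, a₂, 0, a₄, a₆⟩ : WeierstrassCurve ℤ).Δ)
    {F : Type} [Field F] [CharZero F] [Algebra ℚ F] {e : F}
    (he : e ^ 3 + (1 + 4 * (a₂ : F)) * e ^ 2 + 16 * (a₄ : F) * e + 64 * (a₆ : F) = 0) :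
    ∃ (W : WeierstrassCurve ℚ) (_ : W.IsElliptic) (_ : W.IsGloballyMinimal),
      IsOrdinaryAt W 2 ∧ (∀ x : ℚ, ¬ HasRationalTwoTorsionX W x) ∧ ¬ IsSquare W.Δ ∧
      ∃ e' : F, aeval e' (twoDivisionUCubic W) = 0 := by
  obtain ⟨W, hE, hM, hord, ht, hsqW, hroot⟩ := exists_cellCurve_of_standardShape_rootField a₂ a₄ a₆ hodd hirr hsq
  exact ⟨W, hE, hM, hord, ht, hsqW, hroot.mpr ⟨e, he⟩⟩

/-- ★ **A cubic number field containing a root of a shape cubic (`a₄ + a₆` odd, no rational root, `Δ ∉ ℤ²`) is NOT Galois over `ℚ`** (it is a cubic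
`2`-torsion field of a curve with `E(ℚ)[2] = 0`, `Δ ∉ ℚ²`: g33's `not_isGalois_of_root`). [cite: SilvermanAEC2009, III.§1] [cite: Cohen1993, §6.3.3] -/
theorem not_isGalois_of_standardShape_root (hodd : Odd (a₄ + a₆))
    (hirr : ∀ x : ℚ, x ^ 3 + (1 + 4 * (a₂ : ℚ)) * x ^ 2 + 16 * (a₄ : ℚ) * x + 64 * (a₆ : ℚ) ≠ 0)
    (hsq : ¬ IsSquare (⟨1, a₂, 0, a₄, a₆⟩ : WeierstrassCurve ℤ).Δ)
    {F : Type} [Field F] [NumberField F] (hF : Module.finrank ℚ F = 3) {e : F}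
    (he : e ^ 3 + (1 + 4 * (a₂ : F)) * e ^ 2 + 16 * (a₄ : F) * e + 64 * (a₆ : F) = 0) :
    ¬ IsGalois ℚ F := by
  obtain ⟨W, hE, hM, -, ht, hsqW, e', he'⟩ := exists_cellCurve_root_of_standardShape_root hodd hirr hsq he
  exact not_isGalois_of_root W ht hsqW hF he'

/-- ★ **A cubic number field containing a root of a shape cubic EMBEDS INTO `ℚ₂`** (cubic `2`-torsion field of a globally minimal curve good ORDINARY at `2`:
g34's `nonempty_ringHom_padic_two_of_root`). [cite: SilvermanAEC2009, VII.2] [cite: NeukirchANT1999, Ch. II §8 (8.1)–(8.3)] -/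
theorem nonempty_ringHom_padic_two_of_standardShape_root (hodd : Odd (a₄ + a₆))
    (hirr : ∀ x : ℚ, x ^ 3 + (1 + 4 * (a₂ : ℚ)) * x ^ 2 + 16 * (a₄ : ℚ) * x + 64 * (a₆ : ℚ) ≠ 0)
    (hsq : ¬ IsSquare (⟨1, a₂, 0, a₄, a₆⟩ : WeierstrassCurve ℤ).Δ)
    {F : Type} [Field F] [NumberField F] (hF : Module.finrank ℚ F = 3) {e : F}
    (he : e ^ 3 + (1 + 4 * (a₂ : F)) * e ^ 2 + 16 * (a₄ : F) * e + 64 * (a₆ : F) = 0) :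
    Nonempty (F →+* ℚ_[2]) := by
  obtain ⟨W, hE, hM, hord, ht, -, e', he'⟩ := exists_cellCurve_root_of_standardShape_root hodd hirr hsq he
  exact nonempty_ringHom_padic_two_of_root W hord ht hF he'

/-- ★ **A cubic number field containing a root of a shape cubic has `v₂(d_F)` EVEN** (cubic `2`-torsion field of a curve with good reduction at `2`:
g34's `even_padicValInt_two_discr_of_isOrdinaryAt`). [cite: SilvermanAEC2009, VII.5 Prop. 5.1] [cite: Marcus2018, Ch. 2] -/
theorem even_padicValInt_two_discr_of_standardShape_root (hodd : Odd (a₄ + a₆))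
    (hirr : ∀ x : ℚ, x ^ 3 + (1 + 4 * (a₂ : ℚ)) * x ^ 2 + 16 * (a₄ : ℚ) * x + 64 * (a₆ : ℚ) ≠ 0)
    (hsq : ¬ IsSquare (⟨1, a₂, 0, a₄, a₆⟩ : WeierstrassCurve ℤ).Δ)
    {F : Type} [Field F] [NumberField F] (hF : Module.finrank ℚ F = 3) {e : F}
    (he : e ^ 3 + (1 + 4 * (a₂ : F)) * e ^ 2 + 16 * (a₄ : F) * e + 64 * (a₆ : F) = 0) :
    Even (padicValInt 2 (NumberField.discr F)) := by
  obtain ⟨W, hE, hM, hord, ht, hsqW, e', he'⟩ := exists_cellCurve_root_of_standardShape_root hodd hirr hsq he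
  exact even_padicValInt_two_discr_of_isOrdinaryAt W hord ht hsqW hF he'

end RootField

end Summit.BirchSwinnertonDyer.BirchSwinnertonDyer.Theorems.AlignedTransportAtTwoOrdinaryStandardShapeExact

end
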